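import Literature.NumberTheory.EllipticCurves.CanonicalPAdicHeightIntegralityAnomalousProofs
import HarnessLib

/-!
# The canonical cyclotomic `p`-adic height with BOUNDED exponents: Mazur–Tate's value subgroup when `p`
# divides the Tamagawa indices — `ord_p ⟨P, Q⟩ ≥ 1 − 2c`, `ord_p Reg_p ≥ (1 − 2c)·rank` as soon as
# `ord_p #Ẽ(𝔽_p) ≤ c` and `p^{c+1} ∤ [E(ℚ) : E(ℚ) ∩ E⁰(ℚ_ℓ)]` for every `ℓ`

Topic `Literature/NumberTheory/EllipticCurves`; `Proofs`-style companion of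
`CanonicalPAdicHeightIntegralityProofs.lean` / `CanonicalPAdicHeightIntegralityAnomalousProofs.lean`
(THEOREMS ONLY: no definition, no named fact, no instance). Written by the prover seat `bsd-schneider-i1-c2`
(gen 7, cell `bsd-schneider-ideate`) for corner A2 of the BSD rank-one residual, where the two sibling files
stop at the hypothesis `p ∤ [E(ℚ) : E(ℚ) ∩ E⁰(ℚ_ℓ)]` — which FAILS on 842 of the 2 797 A2 class-pairs
`N < 5·10⁵` (kit j258343: the generator meets a component of order divisible by `p` at some bad prime).

## The printed statement and its proof

Mazur–Tate 1983, §3.3 (display after (3.3.4)) with (4.1.1)–(4.1.2) and (4.4) Prop.: the canonical `ρ`-pairing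
of `E/ℚ` with `ρ = ρ_c = log_p ∘ χ` takes values in
`Σ_ℓ (1/m_ℓ) ρ_ℓ(ℚ_ℓ^*) + (1/m_p)[ρ_p(ℚ_p^*) + (1/(m_p n_p²)) ρ_p(ℤ_p^*)]` where `m_ℓ` is the EXPONENT of the
component group met by `E(ℚ)` at `ℓ` and `n_p` that of `Ẽ(𝔽_p)`; since `ρ_c(ℚ_v^*) ⊆ pℤ_p` (`p` odd) this
reads `ord_p ⟨P, Q⟩ ≥ 1 − max(max_ℓ ord_p m_ℓ, 2·ord_p n_p)` — exponents, i.e. a LEAST COMMON MULTIPLE, not a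
product. The sibling files realise the admissible multiple `mP` with `m = N_p · ∏_ℓ [E(ℚ) : E(ℚ) ∩ E⁰(ℚ_ℓ)]`
(MST06 Alg. 3.4 step 1), which is prime to `p` (resp. has `ord_p m = ord_p N_p`) only when `p ∤` every index.
Here the multiple is chosen with lcm bookkeeping — MST06 Alg. 3.4 step 1 VERBATIM: «`m` could be the least
common multiple of the Tamagawa numbers of `E` and `#E(𝔽_p)`» — namely
`m = p^c · N_p' · ∏_ℓ e_ℓ'` with `N_p'`, `e_ℓ'` the prime-to-`p` parts of `N_p` and of the indices `e_ℓ`: if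
`ord_p N_p ≤ c` and `ord_p e_ℓ ≤ c` for all `ℓ`, then `N_p ∣ m` and `e_ℓ ∣ m`, so `mP ∈ E₁(ℚ_p)` (AEC VII.2.1)
and `mP ∈ E⁰(ℚ_ℓ)` for every `ℓ`, `mP` is ADMISSIBLE, `ĥ_p(mP) ∈ pℤ_p` (`norm_pairing_self_le_of_isAdmissible`,
MST06 (1.1)), and `ĥ_p(P) = ĥ_p(mP)/m²` with `ord_p m = c` EXACTLY `c` (not `c + Σ_ℓ ord_p e_ℓ`):
`ord_p ĥ_p(P) ≥ 1 − 2c`. Consequently `ord_p Reg_p ≥ (1 − 2c)·rank` (polarisation for odd `p`, ultrametric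
Hadamard — the sibling file's `norm_padicRegulator_le_pow_of_forall_norm_pairing_le`).

At an ANOMALOUS good prime (`ord_p N_p = 1`) with every Tamagawa index at most ONCE divisible by `p`
(`p² ∤ e_ℓ`) this is the SAME floor `ord_p Reg_p ≥ −rank` as in the index-free case of the sibling file: the
anomalous `p` and the Tamagawa `p` share one factor `p` of the lcm. (On corner A2 of the BSD rank-one residual:
800 of the 842 class-pairs failing `p ∤ e_ℓ` have `max_ℓ ord_p e_ℓ = 1`, kit j258343 re-tabulated.)

## What is here

* (private) `factorization_le_of_not_pow_succ_dvd`, `dvd_pow_mul_of_factorization_le_of_ordCompl_dvd` —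
  bookkeeping for `p^{c+1} ∤ n` and `n ∣ p^c · k`.
* `exists_admissible_nsmul_padicValNat_le` — the admissible multiple `mP` with `m ≠ 0`, `ord_p m ≤ c`.
* `norm_pairing_self_le_of_index_le`, `norm_pairing_le_of_index_le` — `‖⟨P, Q⟩‖ ≤ p^{2c − 1}`.
* `norm_padicRegulator_le_of_index_le` — `‖Reg_p‖ ≤ (p^{2c − 1})^{rank}`;
  `valuation_padicRegulator_ge_of_index_le` — `Reg_p ≠ 0 ⇒ (1 − 2c)·rank ≤ ord_p Reg_p`.
* `valuation_padicRegulator_ge_of_not_sq_dvd_index` — the anomalous floor `ord_p Reg_p ≥ −rank` under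
  `ord_p N_p ≤ 1` and `p² ∤ e_ℓ` (the case used on corner A2).

## References

* B. Mazur, J. Tate, *Canonical height pairings via biextensions*, Progr. Math. 35 (1983): §1.2 (the exponents
  `m_A`, `n_A`), §3.3 (display after (3.3.4)), (4.1.1)–(4.1.2), (4.4) Prop. [MazurTate1983Biext]
* B. Mazur, W. Stein, J. Tate, Doc. Math. Extra Vol. Coates (2006), §1 (1.1), Alg. 3.4 step 1 («least common
  multiple of the Tamagawa numbers of `E` and `#E(𝔽_p)`»), §4 p. 19. [MazurSteinTate2006]
* J. H. Silverman, AEC 2nd ed., VII.2.1, VII.6.1. [SilvermanAEC2009]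
-/

noncomputable section

open scoped Classical

namespace WeierstrassCurve

open Literature.NumberTheory.EllipticCurves

/-! ### §0. Bookkeeping: `p^{c+1} ∤ n` -/

section Bookkeeping

variable {p : ℕ} [Fact p.Prime]

omit [Fact p.Prime] in
/-- `p^{c+1} ∤ n` forces `n ≠ 0`. [folklore] -/
private theorem ne_zero_of_not_pow_succ_dvd {c n : ℕ} (h : ¬ p ^ (c + 1) ∣ n) : n ≠ 0 :=
  fun h0 ↦ h (h0 ▸ dvd_zero _)

/-- `p^{c+1} ∤ n` is `ord_p n ≤ c` (for `n ≠ 0`, automatic). [folklore] -/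
private theorem factorization_le_of_not_pow_succ_dvd {c n : ℕ} (h : ¬ p ^ (c + 1) ∣ n) :
    n.factorization p ≤ c := by
  have hpp : p.Prime := Fact.out
  have hn : n ≠ 0 := ne_zero_of_not_pow_succ_dvd h
  by_contra hlt
  exact h ((hpp.pow_dvd_iff_le_factorization hn).mpr (by omega))

omit [Fact p.Prime] in
/-- `n = p^{ord_p n} · n'` with `p ∤ n'` divides `p^c · k` as soon as `ord_p n ≤ c` and `n' ∣ k`. [folklore] -/
private theorem dvd_pow_mul_of_factorization_le_of_ordCompl_dvd {c n k : ℕ} (hn : n.factorization p ≤ c)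
    (hk : n / p ^ n.factorization p ∣ k) : n ∣ p ^ c * k := by
  rw [← Nat.ordProj_mul_ordCompl_eq_self n p]
  exact mul_dvd_mul (pow_dvd_pow p hn) hk

end Bookkeeping

/-! ### §1. The admissible multiple with lcm bookkeeping and the bounded-exponent value subgroup -/

section BoundedIndex

variable (W : WeierstrassCurve ℚ) [W.IsElliptic] [W.IsGloballyMinimal] (p : ℕ) [Fact p.Prime]

omit [W.IsElliptic] in
/-- **An admissible multiple `mP` with `ord_p m ≤ c`** (Mazur–Stein–Tate Alg. 3.4 step 1 with the LEAST COMMON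
MULTIPLE: «`m` could be the least common multiple of the Tamagawa numbers of `E` and `#E(𝔽_p)`»). For `W/ℚ`
globally minimal, a good prime `p ≥ 3` with `ord_p #Ẽ(𝔽_p) ≤ c` and `p^{c+1} ∤ [E(ℚ) : E(ℚ) ∩ E⁰(ℚ_ℓ)]` for every
prime `ℓ`, and a non-torsion `P ∈ E(ℚ)`: `m = p^c · N_p' · ∏_{ℓ bad for P} e_ℓ'` works, `N_p'`, `e_ℓ'` the
prime-to-`p` parts (`N_p ∣ m` gives `mP ∈ E₁(ℚ_p)`, AEC VII.2.1; `e_ℓ ∣ m` gives `mP ∈ E⁰(ℚ_ℓ)`), and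
`ord_p m = c`. Mazur–Tate's exponents `n_{A_p}`, `m_{A_ℓ}` enter through their MAXIMUM.
[cite: MazurTate1983Biext, §1.2 and (4.1.2)] [cite: MazurSteinTate2006, Alg. 3.4 step 1]
[cite: SilvermanAEC2009, VII.2.1 and VII.6.1] -/
theorem exists_admissible_nsmul_padicValNat_le (hp : 3 ≤ p) (hgood : W.HasGoodReductionAtPrime p) {c : ℕ}
    (hN : padicValNat p (W.reductionPointCount p) ≤ c)
    (hidx : ∀ (ℓ : ℕ) [Fact ℓ.Prime], ¬ p ^ (c + 1) ∣ (W.nonsingularReductionSubgroupAt ℓ).index)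
    (P : W.toAffine.Point) (hP : ¬ IsOfFinAddOrder P) :
    ∃ m : ℕ, m ≠ 0 ∧ padicValNat p m ≤ c ∧ W.IsAdmissible p (m • P) := by
  have hpp : p.Prime := Fact.out
  have hp2 : p ≠ 2 := by omega
  have hΔ : ¬ (p : ℤ) ∣ minimalDiscriminantInt W :=
    not_dvd_minimalDiscriminantInt_of_hasGoodReductionAtPrime' W p hgood
  set N := W.reductionPointCount p with hNdef
  have hN0 : N ≠ 0 := (W.reductionPointCount_pos p).ne'
  have hNfac : N.factorization p ≤ c := by rw [Nat.factorization_def N hpp]; exact hN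
  -- the prime-to-`p` part of `N_p`
  set N' := N / p ^ N.factorization p with hN'def
  have hN'p : ¬ p ∣ N' := Nat.not_dvd_ordCompl hpp hN0
  have hN'0 : N' ≠ 0 := fun h0 ↦ hN'p (h0 ▸ dvd_zero p)
  obtain ⟨x, y, h, rfl⟩ := exists_eq_some_of_not_isOfFinAddOrder hP
  -- the finitely many primes at which `P` may have singular reduction
  obtain ⟨S, hS⟩ := exists_finset_forall_hasNonsingularReductionAt h
  set e0 : ℕ → ℕ := fun ℓ =>
    if hℓ : ℓ.Prime then (haveI := Fact.mk hℓ; (W.nonsingularReductionSubgroupAt ℓ).index) else 1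
    with he0def
  have he0c : ∀ ℓ, ¬ p ^ (c + 1) ∣ e0 ℓ := fun ℓ => by
    simp only [he0def]
    split_ifs with hℓ
    · haveI := Fact.mk hℓ; exact hidx ℓ
    · intro hdvd
      have h1 : p ^ (c + 1) = 1 := Nat.dvd_one.mp hdvd
      rcases pow_eq_one_iff.mp h1 with h1' | h1'
      · exact hpp.one_lt.ne' h1'
      · exact Nat.succ_ne_zero c h1'
  -- prime-to-`p` parts of the indices
  set e1 : ℕ → ℕ := fun ℓ => e0 ℓ / p ^ (e0 ℓ).factorization p with he1def
  have he1 : ∀ ℓ, ¬ p ∣ e1 ℓ := fun ℓ => Nat.not_dvd_ordCompl hpp (ne_zero_of_not_pow_succ_dvd (he0c ℓ))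
  set M₀ := ∏ ℓ ∈ S, e1 ℓ with hM₀
  have hM₀p : ¬ p ∣ M₀ := by
    rw [hM₀]
    intro hdvd
    obtain ⟨ℓ, -, hℓ⟩ := (Prime.dvd_finsetProd_iff hpp.prime _).mp hdvd
    exact he1 ℓ hℓ
  have hM₀0 : M₀ ≠ 0 := fun h0 ↦ hM₀p (h0 ▸ dvd_zero p)
  -- the multiple
  set m := p ^ c * (N' * M₀) with hmdef
  have hpc0 : p ^ c ≠ 0 := pow_ne_zero c hpp.ne_zero
  have hm0 : m ≠ 0 := Nat.mul_ne_zero hpc0 (Nat.mul_ne_zero hN'0 hM₀0)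
  have hvm : padicValNat p m = c := by
    rw [hmdef, padicValNat.mul hpc0 (Nat.mul_ne_zero hN'0 hM₀0), padicValNat.prime_pow,
      padicValNat.mul hN'0 hM₀0, padicValNat.eq_zero_of_not_dvd hN'p, padicValNat.eq_zero_of_not_dvd hM₀p,
      add_zero, add_zero]
  -- `e_ℓ ∣ m` at the primes of `S`, hence `mP ∈ E⁰(ℚ_ℓ)` everywhere
  have hmP : ∀ ℓ : ℕ, (hℓ : ℓ.Prime) → haveI := Fact.mk hℓ;
      m • (Affine.Point.some x y h) ∈ W.nonsingularReductionSubgroupAt ℓ := by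
    intro ℓ hℓ
    haveI := Fact.mk hℓ
    by_cases hℓS : ℓ ∈ S
    · have hdvd : e0 ℓ ∣ m := by
        rw [hmdef]
        refine dvd_pow_mul_of_factorization_le_of_ordCompl_dvd (factorization_le_of_not_pow_succ_dvd (he0c ℓ))
          ?_
        exact (Finset.dvd_prod_of_mem e1 hℓS).trans (dvd_mul_left M₀ N')
      obtain ⟨k, hk⟩ := hdvd
      rw [hk, mul_nsmul (Affine.Point.some x y h)]
      refine AddSubgroup.nsmul_mem _ ?_ k
      have : e0 ℓ = (W.nonsingularReductionSubgroupAt ℓ).index := by simp only [he0def, dif_pos hℓ]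
      rw [this]
      exact AddSubgroup.nsmul_index_mem _ _
    · exact AddSubgroup.nsmul_mem _ ((mem_nonsingularReductionSubgroupAt_iff _).mpr
        ((W.reducesNonsingularlyAt_some ℓ h).mpr (hS ℓ hℓ hℓS))) m
  -- `N_p ∣ m`, hence `mP ∈ E₁(ℚ_p)`
  have hNm : N ∣ m := by
    rw [hmdef]
    exact dvd_pow_mul_of_factorization_le_of_ordCompl_dvd hNfac (dvd_mul_right N' M₀)
  obtain ⟨t, ht⟩ := hNm
  have hQfin : ¬ IsOfFinAddOrder (m • (Affine.Point.some x y h)) := fun hf => hP (hf.of_nsmul hm0)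
  have hker := W.isInReductionKernel_reductionPointCount_nsmul p hΔ
    (W.toPadicPoint p (t • Affine.Point.some x y h))
  rw [← map_nsmul, ← mul_nsmul, ← hNdef] at hker
  have htm : t * N = m := by rw [ht, mul_comm]
  rw [htm] at hker
  obtain ⟨xq, yq, hq, hQeq⟩ := exists_eq_some_of_not_isOfFinAddOrder hQfin
  rw [hQeq] at hmP hQfin hker
  rw [toPadicPoint_some, isInReductionKernel_some] at hker
  refine ⟨m, hm0, hvm.le, ?_⟩
  rw [hQeq]
  refine ⟨hQfin, hker, (W.inSigmaDisc_of_one_lt_norm hp2 hq hker).2, fun ℓ hℓ => ?_⟩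
  haveI := Fact.mk hℓ
  exact (W.reducesNonsingularlyAt_some ℓ _).mp ((mem_nonsingularReductionSubgroupAt_iff _).mp (hmP ℓ hℓ))

omit [W.IsElliptic] in
/-- **`‖⟨P, P⟩‖ ≤ p^{2c − 1}` at a good prime `p ≥ 3` with `ord_p #Ẽ(𝔽_p) ≤ c` and
`p^{c+1} ∤ [E(ℚ) : E(ℚ) ∩ E⁰(ℚ_ℓ)]` for all `ℓ`** (THE canonical datum): `⟨mP, mP⟩ = m²⟨P, P⟩ ∈ pℤ_p` for the
admissible multiple of `exists_admissible_nsmul_padicValNat_le` (`norm_pairing_self_le_of_isAdmissible`), and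
`‖m‖ ≥ p^{−c}`. Mazur–Tate's `ord_p ⟨P, Q⟩ ≥ 1 − max(max_ℓ ord_p m_ℓ, 2·ord_p n_p)` specialised to
`max ≤ 2c`. [cite: MazurTate1983Biext, §3.3 (display after (3.3.4)) and (4.1.1)]
[cite: MazurSteinTate2006, §1 (1.1), Alg. 3.4 step 1] -/
theorem norm_pairing_self_le_of_index_le (hp : 3 ≤ p) (hgood : W.HasGoodReductionAtPrime p) {c : ℕ}
    (hN : padicValNat p (W.reductionPointCount p) ≤ c)
    (hidx : ∀ (ℓ : ℕ) [Fact ℓ.Prime], ¬ p ^ (c + 1) ∣ (W.nonsingularReductionSubgroupAt ℓ).index)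
    {D : PAdicHeightData W p} (hD : D.IsCanonical) (P : W.toAffine.Point) :
    ‖D.pairing P P‖ ≤ (p : ℝ) ^ (2 * (c : ℤ) - 1) := by
  have hpp : p.Prime := Fact.out
  have hp2 : p ≠ 2 := by omega
  have hp1 : (1 : ℝ) < p := by exact_mod_cast hpp.one_lt
  have hp0 : (0 : ℝ) < p := by positivity
  by_cases hP : IsOfFinAddOrder P
  · rw [D.map_torsion P P hP, norm_zero]; positivity
  obtain ⟨m, hm0, hvm, hmP⟩ := exists_admissible_nsmul_padicValNat_le W p hp hgood hN hidx P hP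
  have hmm : D.pairing (m • P) (m • P) = ((m : ℚ_[p]) * m) * D.pairing P P := by
    rw [map_nsmul (D.pairing (m • P)) m P, D.symm (m • P) P, map_nsmul (D.pairing P) m P, smul_smul,
      nsmul_eq_mul, Nat.cast_mul]
  have key := norm_pairing_self_le_of_isAdmissible W p hp2 hD hmP
  rw [hmm, norm_mul, norm_mul] at key
  -- `‖m‖ = p^{-ord_p m} ≥ p^{-c}`
  have hmnorm : ‖(m : ℚ_[p])‖ = (p : ℝ) ^ (-(padicValNat p m : ℤ)) := by
    have : ((m : ℚ) : ℚ_[p]) = (m : ℚ_[p]) := by push_cast; rfl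
    rw [← this, Padic.norm_eq_zpow_neg_valuation (by exact_mod_cast hm0), Padic.valuation_ratCast,
      padicValRat.of_nat]
  have hmge : (p : ℝ) ^ (-(c : ℤ)) ≤ ‖(m : ℚ_[p])‖ := by
    rw [hmnorm]
    exact zpow_le_zpow_right₀ hp1.le (by omega)
  have hcpos : (0 : ℝ) < (p : ℝ) ^ (-(c : ℤ)) := zpow_pos hp0 _
  have hnn : 0 ≤ ‖D.pairing P P‖ := norm_nonneg _
  -- `p^{-c} · p^{-c} · ‖⟨P,P⟩‖ ≤ ‖m‖ · ‖m‖ · ‖⟨P,P⟩‖ ≤ p⁻¹`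
  have key' : (p : ℝ) ^ (-(c : ℤ)) * (p : ℝ) ^ (-(c : ℤ)) * ‖D.pairing P P‖ ≤ (p : ℝ)⁻¹ := by
    refine le_trans ?_ key
    exact mul_le_mul_of_nonneg_right (mul_le_mul hmge hmge hcpos.le (norm_nonneg _)) hnn
  have key'' : ‖D.pairing P P‖ ≤ (p : ℝ)⁻¹ / ((p : ℝ) ^ (-(c : ℤ)) * (p : ℝ) ^ (-(c : ℤ))) := by
    rw [le_div_iff₀ (mul_pos hcpos hcpos)]
    linarith [key', mul_comm (‖D.pairing P P‖) ((p : ℝ) ^ (-(c : ℤ)) * (p : ℝ) ^ (-(c : ℤ)))]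
  refine key''.trans (le_of_eq ?_)
  rw [← zpow_add₀ hp0.ne', ← zpow_neg_one, div_eq_mul_inv, ← zpow_neg, ← zpow_add₀ hp0.ne']
  congr 1
  ring

omit [W.IsElliptic] in
/-- **`‖⟨P, Q⟩‖ ≤ p^{2c − 1}` for all `P, Q`** (same hypotheses; polarisation, `‖2‖ = 1` for odd `p`).
Mazur–Tate 1983 §3.3 for `E/ℚ`, `ρ = ρ_c`, with the exponents `m_ℓ`, `n_p` bounded by `p^c`.
[cite: MazurTate1983Biext, §3.3 (display after (3.3.4)), (4.1.1)–(4.1.2), (4.4) Prop.] -/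
theorem norm_pairing_le_of_index_le (hp : 3 ≤ p) (hgood : W.HasGoodReductionAtPrime p) {c : ℕ}
    (hN : padicValNat p (W.reductionPointCount p) ≤ c)
    (hidx : ∀ (ℓ : ℕ) [Fact ℓ.Prime], ¬ p ^ (c + 1) ∣ (W.nonsingularReductionSubgroupAt ℓ).index)
    {D : PAdicHeightData W p} (hD : D.IsCanonical) (P Q : W.toAffine.Point) :
    ‖D.pairing P Q‖ ≤ (p : ℝ) ^ (2 * (c : ℤ) - 1) := by
  have hpp : p.Prime := Fact.out
  have hp2 : p ≠ 2 := by omega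
  set b : ℝ := (p : ℝ) ^ (2 * (c : ℤ) - 1) with hb
  have hdiag : ∀ R : W.toAffine.Point, ‖D.pairing R R‖ ≤ b := fun R ↦
    norm_pairing_self_le_of_index_le W p hp hgood hN hidx hD R
  have hpol : (2 : ℚ_[p]) * D.pairing P Q =
      D.pairing (P + Q) (P + Q) - D.pairing P P - D.pairing Q Q := by
    simp only [map_add, AddMonoidHom.add_apply, D.symm Q P]; ring
  have hsub : ∀ a b : ℚ_[p], ‖a - b‖ ≤ max ‖a‖ ‖b‖ := fun a b ↦ by
    rw [sub_eq_add_neg, ← norm_neg b]; exact IsUltrametricDist.norm_add_le_max a (-b)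
  have h2 : ‖(2 : ℚ_[p])‖ = 1 := by
    have : ((2 : ℕ) : ℚ_[p]) = 2 := by norm_num
    rw [← this, Padic.norm_natCast_eq_one_iff]
    exact (Nat.coprime_primes hpp Nat.prime_two).mpr hp2
  have key : ‖(2 : ℚ_[p]) * D.pairing P Q‖ ≤ b := by
    rw [hpol]
    refine (hsub _ _).trans (max_le ?_ (hdiag Q))
    exact (hsub _ _).trans (max_le (hdiag _) (hdiag P))
  rwa [norm_mul, h2, one_mul] at key

/-- **`‖Reg_p‖ ≤ (p^{2c − 1})^{rank}`** at a good prime `p ≥ 3` with `ord_p #Ẽ(𝔽_p) ≤ c` and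
`p^{c+1} ∤ [E(ℚ) : E(ℚ) ∩ E⁰(ℚ_ℓ)]` for all `ℓ`, for THE canonical datum (ultrametric Hadamard on a Mordell–Weil
basis, `norm_padicRegulator_le_pow_of_forall_norm_pairing_le`). [cite: MazurTate1983Biext, §3.3 and (4.1.1)]
[cite: KunduRay2024, §3 (display before Thm 3.6)] -/
theorem norm_padicRegulator_le_of_index_le (hp : 3 ≤ p) (hgood : W.HasGoodReductionAtPrime p) {c : ℕ}
    (hN : padicValNat p (W.reductionPointCount p) ≤ c)
    (hidx : ∀ (ℓ : ℕ) [Fact ℓ.Prime], ¬ p ^ (c + 1) ∣ (W.nonsingularReductionSubgroupAt ℓ).index)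
    {D : PAdicHeightData W p} (hD : D.IsCanonical) :
    ‖padicRegulator D‖ ≤ ((p : ℝ) ^ (2 * (c : ℤ) - 1)) ^ W.mordellWeilRank :=
  norm_padicRegulator_le_pow_of_forall_norm_pairing_le W p (by positivity)
    (norm_pairing_le_of_index_le W p hp hgood hN hidx hD)

/-- **Valuation form: `Reg_p ≠ 0 ⇒ (1 − 2c) · rank ≤ ord_p Reg_p`** (same hypotheses). At an anomalous
`p` (`ord_p #Ẽ(𝔽_p) = 1`) with every Tamagawa index at most once divisible by `p` (`c = 1`) in rank one this is the
floor `ord_p Reg_p ≥ −1` — the same as with `p ∤` the indices (`valuation_padicRegulator_ge_of_not_dvd_index`),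
because the two factors `p` are SHARED in the least common multiple. [cite: MazurTate1983Biext, §3.3 and (4.1.1)]
[cite: MazurSteinTate2006, Alg. 3.4 step 1 and §4 p. 19] -/
theorem valuation_padicRegulator_ge_of_index_le (hp : 3 ≤ p) (hgood : W.HasGoodReductionAtPrime p) {c : ℕ}
    (hN : padicValNat p (W.reductionPointCount p) ≤ c)
    (hidx : ∀ (ℓ : ℕ) [Fact ℓ.Prime], ¬ p ^ (c + 1) ∣ (W.nonsingularReductionSubgroupAt ℓ).index)
    {D : PAdicHeightData W p} (hD : D.IsCanonical) (hR : padicRegulator D ≠ 0) :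
    (1 - 2 * (c : ℤ)) * W.mordellWeilRank ≤ (padicRegulator D).valuation := by
  have hpp : p.Prime := Fact.out
  have hp1 : (1 : ℝ) < p := by exact_mod_cast hpp.one_lt
  have h := norm_padicRegulator_le_of_index_le W p hp hgood hN hidx hD
  rw [Padic.norm_eq_zpow_neg_valuation hR, ← zpow_natCast, ← zpow_mul] at h
  have h' := (zpow_le_zpow_iff_right₀ hp1).mp h
  linarith

/-- **The anomalous floor with Tamagawa indices once divisible by `p`: `Reg_p ≠ 0 ⇒ −rank ≤ ord_p Reg_p`**
under `ord_p #Ẽ(𝔽_p) ≤ 1` (any good `p ≥ 5`, or `p = 3` with `#Ẽ(𝔽_3) ≠ 9`... — on the BSD rank-one residual's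
corner A2 `ord_p #Ẽ(𝔽_p) = 1`) and `p² ∤ [E(ℚ) : E(ℚ) ∩ E⁰(ℚ_ℓ)]` for every `ℓ` (`c = 1` of
`valuation_padicRegulator_ge_of_index_le`). [cite: MazurTate1983Biext, §3.3 and (4.1.1)]
[cite: MazurSteinTate2006, Alg. 3.4 step 1 and §4 p. 19] -/
theorem valuation_padicRegulator_ge_of_not_sq_dvd_index (hp : 3 ≤ p) (hgood : W.HasGoodReductionAtPrime p)
    (hN : padicValNat p (W.reductionPointCount p) ≤ 1)
    (hidx : ∀ (ℓ : ℕ) [Fact ℓ.Prime], ¬ p ^ 2 ∣ (W.nonsingularReductionSubgroupAt ℓ).index)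
    {D : PAdicHeightData W p} (hD : D.IsCanonical) (hR : padicRegulator D ≠ 0) :
    -(W.mordellWeilRank : ℤ) ≤ (padicRegulator D).valuation := by
  have h := valuation_padicRegulator_ge_of_index_le W p hp hgood (c := 1) hN hidx hD hR
  push_cast at h
  linarith

end BoundedIndex

end WeierstrassCurve

end
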